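import Mathlib
import Summits.MatrixMultiplication.MatrixMultiplication.Theorems.HiddenToeplitzCornersHiddenCornerLemmaRStein
import Summits.MatrixMultiplication.MatrixMultiplication.Theorems.HiddenToeplitzCornersHiddenCornerLemmaRLoToolkit
import Summits.MatrixMultiplication.MatrixMultiplication.Theorems.HiddenToeplitzCornersHiddenCornerLemmaRGconstStrip

/-!
# The G-const dual law for `p ≤ 1` (hidden-corner lemma, crux stmt-MatrixMultiplication-10752)

Support file for crux item `stmt-MatrixMultiplication-10752`
(`Summit.MatrixMultiplication.MatrixMultiplication.Theses.HiddenToeplitzCorners.HiddenCornerLemmaR`),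
line `frobenius-dual-short-syzygies`, stub `stub_gconstDualLaw` restricted to `p ≤ 1` constant
generators with an ARBITRARY generator column `G₀` (`hclR_gconstDualLaw_p_le_one`, conclusion
`r ≤ 2 * p`).

* `p = 0`, or `G₀ = 0`: the displacement `M - Z M Zᵀ = G₀ Hᵀ` vanishes, so `M = 0` by Stein
  uniqueness (`hclR_eq_zero_of_stein`), contradicting `det M ≠ 0` (`hclR_p1_det_eq_zero`) unless
  `N = 0`, when `r ≤ N = 0`.
* `p = 1`, `g := G₀ · 0 ≠ 0` (`hclR_p1_core`): write `g = Z^γ gt` with `gt 0 ≠ 0`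
  (`hclR_lo_val_split`); the lower-triangular Toeplitz matrix `L := Lo gt` is a unit commuting
  with `Z`, `g = L e_γ` (`hclR_p1_lo_col`) and `Lo g = Z^γ L` (`hclR_p1_lo_shift`).  Multiplying
  the instance on the left by `L⁻¹` gives the STRIP instance with the single cut row `γ`
  (`L⁻¹ M`, `L⁻¹ F`, same `E`, `H`, `X₀`); its annihilator hypothesis at `Λ` is the original
  one at `(L⁻¹)ᵀ Λ` because `(Lo g)ᵀ (L⁻¹)ᵀ = (Zᵀ)^γ`.  The strip theorem
  `hclR_gconstDualLaw_strip` (`HiddenCornerLemmaRGconstStrip`) then gives `r ≤ 2 · 1 - 1 ≤ 2`.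
-/

set_option linter.dupNamespace false

namespace Summit.MatrixMultiplication.MatrixMultiplication.Theorems

open Matrix BigOperators Finset

/-- Stein degeneracy: if `0 < N` and the displacement `M - Z M Zᵀ` vanishes then `det M = 0`
(indeed `M = 0`, `hclR_eq_zero_of_stein`). -/
theorem hclR_p1_det_eq_zero {N : ℕ} (hN : 0 < N) (M : Matrix (Fin N) (Fin N) ℂ)
    (h : M - (Matrix.of fun i j : Fin N => if (i : ℕ) = (j : ℕ) + 1 then (1 : ℂ) else 0) * M *
      (Matrix.of fun i j : Fin N => if (i : ℕ) = (j : ℕ) + 1 then (1 : ℂ) else 0)ᵀ = 0) :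
    M.det = 0 := by
  have hM0 : M = 0 := hclR_eq_zero_of_stein M (sub_eq_zero.mp h)
  haveI : Nonempty (Fin N) := ⟨⟨0, hN⟩⟩
  rw [hM0, Matrix.det_zero]

/-- `Lo (Z^γ gt) = Z^γ * Lo gt`: the lower-triangular Toeplitz matrix of a shifted vector. -/
theorem hclR_p1_lo_shift {N : ℕ} (γ : ℕ) (gt : Fin N → ℂ) :
    (Matrix.of fun i j : Fin N => if (j : ℕ) ≤ (i : ℕ) then
        ((Matrix.of fun i j : Fin N => if (i : ℕ) = (j : ℕ) + 1 then (1 : ℂ) else 0) ^ γ *ᵥ gt)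
          ⟨(i : ℕ) - j, Nat.lt_of_le_of_lt (Nat.sub_le _ _) i.2⟩ else 0) =
      (Matrix.of fun i j : Fin N => if (i : ℕ) = (j : ℕ) + 1 then (1 : ℂ) else 0) ^ γ *
        (Matrix.of fun i j : Fin N => if (j : ℕ) ≤ (i : ℕ) then
          gt ⟨(i : ℕ) - j, Nat.lt_of_le_of_lt (Nat.sub_le _ _) i.2⟩ else 0) := by
  ext i j
  rw [Matrix.mul_apply]
  simp only [Matrix.of_apply, hclR_shift_pow_mulVec, hclR_shift_pow_apply, ite_mul, one_mul,
    zero_mul]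
  by_cases hγ : γ ≤ (i : ℕ)
  · rw [Finset.sum_eq_single ⟨(i : ℕ) - γ, by omega⟩]
    · rw [if_pos (show (i : ℕ) = ((i : ℕ) - γ) + γ by omega)]
      by_cases hj : (j : ℕ) ≤ (i : ℕ) - γ
      · rw [if_pos hj, if_pos (show (j : ℕ) ≤ (i : ℕ) by omega),
          dif_pos (show γ ≤ (i : ℕ) - j by omega)]
        congr 1
        exact Fin.ext (by simp only; omega)
      · rw [if_neg hj]
        by_cases hj' : (j : ℕ) ≤ (i : ℕ)
        · rw [if_pos hj', dif_neg (by omega)]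
        · rw [if_neg hj']
    · intro m _ hm
      rw [if_neg]
      intro h
      exact hm (Fin.ext (by simp only at h ⊢; omega))
    · simp
  · rw [Finset.sum_eq_zero]
    · by_cases hj : (j : ℕ) ≤ (i : ℕ)
      · rw [if_pos hj, dif_neg (by omega)]
      · rw [if_neg hj]
    · intro m _
      rw [if_neg (by omega)]

/-- `Z^γ gt = Lo gt · e_γ`, as one-column matrices: the generator column is `L * S` with `S` the
strip generator of the single cut row `γ`. -/
theorem hclR_p1_lo_col {N : ℕ} (γ : ℕ) (hγN : γ < N) (gt : Fin N → ℂ) :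
    (Matrix.of fun (i : Fin N) (_ : Fin 1) =>
        ((Matrix.of fun i j : Fin N => if (i : ℕ) = (j : ℕ) + 1 then (1 : ℂ) else 0) ^ γ *ᵥ gt) i) =
      (Matrix.of fun i j : Fin N => if (j : ℕ) ≤ (i : ℕ) then
          gt ⟨(i : ℕ) - j, Nat.lt_of_le_of_lt (Nat.sub_le _ _) i.2⟩ else 0) *
        Matrix.of fun (i : Fin N) (_ : Fin 1) => if (i : ℕ) = γ then (1 : ℂ) else 0 := by
  ext i k
  rw [Matrix.mul_apply]
  simp only [Matrix.of_apply, hclR_shift_pow_mulVec, mul_ite, mul_one, mul_zero]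
  rw [Finset.sum_eq_single ⟨γ, hγN⟩]
  · rw [if_pos rfl]
    by_cases h : γ ≤ (i : ℕ)
    · rw [dif_pos h, if_pos h]
    · rw [dif_neg h, if_neg h]
  · intro m _ hm
    rw [if_neg (fun h => hm (Fin.ext h))]
  · simp

/-- **The `p = 1` core.**  The G-const dual law for one constant generator in valuation form
`g = Z^γ gt`, `gt 0 ≠ 0`, `γ < N`: multiplying on the left by `(Lo gt)⁻¹` turns the instance into a
strip instance with the single cut row `γ` and the same frame, so the strip theorem gives `r ≤ 1`. -/
theorem hclR_p1_core (r N γ : ℕ) (hN : 0 < N) (hγN : γ < N) (gt : Fin N → ℂ)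
    (hgt0 : gt ⟨0, hN⟩ ≠ 0) (E F : Matrix (Fin N) (Fin r) ℂ) (M : Matrix (Fin N) (Fin N) ℂ)
    (H : Matrix (Fin N) (Fin 1) ℂ) (X₀ : Matrix (Fin r) (Fin r) ℂ) (hE : E.rank = r)
    (hF : F.rank = r)
    (hann : ∀ Λ : Matrix (Fin N) (Fin r) ℂ,
      (∀ k : Fin 1,
        (∑ c : Fin r,
          (∑ j : Fin N,
            (((∑ i : Fin N,
                (Matrix.of fun (i : Fin N) (_ : Fin 1) =>
                    ((Matrix.of fun i j : Fin N => if (i : ℕ) = (j : ℕ) + 1 then (1 : ℂ) else 0) ^ γ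
                      *ᵥ gt) i) i k •
                  (Matrix.of fun i j : Fin N => if (i : ℕ) = (j : ℕ) + 1 then (1 : ℂ) else 0)ᵀ ^ (i : ℕ))
              *ᵥ (Λᵀ c)) j) •
            (Matrix.of fun i j : Fin N => if (i : ℕ) = (j : ℕ) + 1 then (1 : ℂ) else 0)ᵀ ^ (j : ℕ))
          *ᵥ (Eᵀ c)) = 0) →
      Λᵀ * F = 0)
    (hM : M - (Matrix.of fun i j : Fin N => if (i : ℕ) = (j : ℕ) + 1 then (1 : ℂ) else 0) * M *
        (Matrix.of fun i j : Fin N => if (i : ℕ) = (j : ℕ) + 1 then (1 : ℂ) else 0)ᵀ =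
      (Matrix.of fun (i : Fin N) (_ : Fin 1) =>
        ((Matrix.of fun i j : Fin N => if (i : ℕ) = (j : ℕ) + 1 then (1 : ℂ) else 0) ^ γ *ᵥ gt) i) *
        Hᵀ)
    (hME : M * E = F * X₀) (hdet : M.det ≠ 0) : r ≤ 1 := by
  set Z : Matrix (Fin N) (Fin N) ℂ :=
    Matrix.of fun i j : Fin N => if (i : ℕ) = (j : ℕ) + 1 then (1 : ℂ) else 0 with hZ
  set L : Matrix (Fin N) (Fin N) ℂ := Matrix.of fun i j : Fin N => if (j : ℕ) ≤ (i : ℕ) then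
      gt ⟨(i : ℕ) - j, Nat.lt_of_le_of_lt (Nat.sub_le _ _) i.2⟩ else 0 with hL
  set S : Matrix (Fin N) (Fin 1) ℂ :=
    Matrix.of fun (i : Fin N) (_ : Fin 1) => if (i : ℕ) = γ then (1 : ℂ) else 0 with hS
  set G : Matrix (Fin N) (Fin 1) ℂ := Matrix.of fun (i : Fin N) (_ : Fin 1) => (Z ^ γ *ᵥ gt) i
    with hG
  -- the normalising unit `L = Lo gt` and its inverse
  have hLU : IsUnit L := hclR_lo_isUnit hN gt hgt0
  have hLdet : IsUnit L.det := (Matrix.isUnit_iff_isUnit_det L).mp hLU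
  have hLiL : L⁻¹ * L = 1 := Matrix.nonsing_inv_mul L hLdet
  have hLLi : L * L⁻¹ = 1 := Matrix.mul_nonsing_inv L hLdet
  have hLidet : IsUnit L⁻¹.det := Matrix.isUnit_nonsing_inv_det L hLdet
  have hZL : Z * L = L * Z := by rw [hZ, hL]; exact (hclR_commute_shift_lo gt).eq
  have hZLi : Z * L⁻¹ = L⁻¹ * Z := by
    calc Z * L⁻¹ = L⁻¹ * L * Z * L⁻¹ := by rw [hLiL, Matrix.one_mul]
      _ = L⁻¹ * (L * Z) * L⁻¹ := by simp only [Matrix.mul_assoc]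
      _ = L⁻¹ * (Z * L) * L⁻¹ := by rw [hZL]
      _ = L⁻¹ * Z * (L * L⁻¹) := by simp only [Matrix.mul_assoc]
      _ = L⁻¹ * Z := by rw [hLLi, Matrix.mul_one]
  have hZγLi : Z ^ γ * L⁻¹ = L⁻¹ * Z ^ γ := (Commute.pow_left (show Commute Z L⁻¹ from hZLi) γ).eq
  -- the generator column is `L * S`
  have hGLS : G = L * S := by rw [hG, hL, hS, hZ]; exact hclR_p1_lo_col γ hγN gt
  have hLiG : L⁻¹ * G = S := by rw [hGLS, ← Matrix.mul_assoc, hLiL, Matrix.one_mul]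
  -- the generator's symbol matrix `Σ g i (Zᵀ)^i = (Z^γ L)ᵀ`, the strip symbol `(Zᵀ)^γ`
  have hW : ∀ k : Fin 1, (∑ i : Fin N, G i k • Zᵀ ^ (i : ℕ)) = (Z ^ γ * L)ᵀ := by
    intro k
    rw [hZ, hL, ← hclR_p1_lo_shift γ gt, hclR_lo_eq_sum, Matrix.transpose_sum]
    refine Finset.sum_congr rfl fun i _ => ?_
    rw [Matrix.transpose_smul, Matrix.transpose_pow, hG, Matrix.of_apply]
  have hWS : ∀ k : Fin 1, (∑ i : Fin N, S i k • Zᵀ ^ (i : ℕ)) = Zᵀ ^ γ := by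
    intro k
    rw [Finset.sum_eq_single ⟨γ, hγN⟩]
    · rw [hS, Matrix.of_apply, if_pos rfl, one_smul]
    · intro i _ hi
      rw [hS, Matrix.of_apply, if_neg (fun h => hi (Fin.ext h)), zero_smul]
    · simp
  -- the transformed instance `(L⁻¹ M, L⁻¹ F, E, H, X₀)` is a strip instance with cut row `γ`
  have hF' : (L⁻¹ * F).rank = r := by
    rw [Matrix.rank_mul_eq_right_of_isUnit_det L⁻¹ F hLidet, hF]
  have hM' : L⁻¹ * M - Z * (L⁻¹ * M) * Zᵀ = S * Hᵀ := by
    have e1 : Z * (L⁻¹ * M) * Zᵀ = L⁻¹ * (Z * M * Zᵀ) := by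
      rw [← Matrix.mul_assoc, hZLi]; simp only [Matrix.mul_assoc]
    rw [e1, ← Matrix.mul_sub, hM, ← Matrix.mul_assoc, hLiG]
  have hME' : L⁻¹ * M * E = L⁻¹ * F * X₀ := by rw [Matrix.mul_assoc, hME, Matrix.mul_assoc]
  have hdet' : (L⁻¹ * M).det ≠ 0 := by
    rw [Matrix.det_mul]; exact mul_ne_zero hLidet.ne_zero hdet
  have hann' : ∀ Λ : Matrix (Fin N) (Fin r) ℂ,
      (∀ k : Fin 1, (∑ c : Fin r, (∑ j : Fin N,
        (((∑ i : Fin N, S i k • Zᵀ ^ (i : ℕ)) *ᵥ (Λᵀ c)) j) • Zᵀ ^ (j : ℕ)) *ᵥ (Eᵀ c)) = 0) →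
      Λᵀ * (L⁻¹ * F) = 0 := by
    intro Λ hΛ
    have key : ∀ (k : Fin 1) (c : Fin r),
        (∑ i : Fin N, G i k • Zᵀ ^ (i : ℕ)) *ᵥ ((L⁻¹ᵀ * Λ)ᵀ c) =
          (∑ i : Fin N, S i k • Zᵀ ^ (i : ℕ)) *ᵥ (Λᵀ c) := by
      intro k c
      rw [hWS k, Matrix.transpose_mul, Matrix.transpose_transpose,
        show (Λᵀ * L⁻¹) c = Λᵀ c ᵥ* L⁻¹ from rfl, ← Matrix.mulVec_transpose, hW k,
        Matrix.mulVec_mulVec, ← Matrix.transpose_mul, ← Matrix.mul_assoc, ← hZγLi, Matrix.mul_assoc,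
        hLiL, Matrix.mul_one, Matrix.transpose_pow]
    have h1 : (L⁻¹ᵀ * Λ)ᵀ * F = 0 := by
      refine hann (L⁻¹ᵀ * Λ) fun k => ?_
      rw [← hΛ k]
      refine Finset.sum_congr rfl fun c _ => ?_
      rw [key k c]
    rw [Matrix.transpose_mul, Matrix.transpose_transpose, Matrix.mul_assoc] at h1
    exact h1
  have h := hclR_gconstDualLaw_strip r N 1 (fun _ => γ)
    (fun a b hab => absurd (Subsingleton.elim a b) hab.ne) (fun _ => hγN) E (L⁻¹ * F) (L⁻¹ * M) H X₀
    hE hF' hann' hM' hME' hdet'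
  omega

/-- **The G-const dual law for `p ≤ 1` (any generator column).**  `stub_gconstDualLaw` of the
hidden-corner lemma with the extra hypothesis `p ≤ 1`: if `E`, `F` are rank-`r` frames, `F` is
killed by the explicit annihilator attached to `(E, G₀)`, and an invertible `M` with
`M - Z M Zᵀ = G₀ Hᵀ` maps the frame into the targets (`M E = F X₀`), then `r ≤ 2 p`.  For `p = 0`
(or `G₀ = 0`) the class is `{0}` (Stein uniqueness), so `N = 0 = r`; for `p = 1` a lower-triangular
Toeplitz unit normalises the generator to `e_γ` and the strip theorem applies (`hclR_p1_core`). -/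
theorem hclR_gconstDualLaw_p_le_one :
    ∀ (r N p : ℕ) (G₀ : Matrix (Fin N) (Fin p) ℂ) (E F : Matrix (Fin N) (Fin r) ℂ)
      (M : Matrix (Fin N) (Fin N) ℂ) (H : Matrix (Fin N) (Fin p) ℂ) (X₀ : Matrix (Fin r) (Fin r) ℂ),
      p ≤ 1 → E.rank = r → F.rank = r →
      (∀ Λ : Matrix (Fin N) (Fin r) ℂ,
        (∀ k : Fin p,
          (∑ c : Fin r,
            (∑ j : Fin N,
              (((∑ i : Fin N, G₀ i k •
                  (Matrix.of fun i j : Fin N => if (i : ℕ) = (j : ℕ) + 1 then (1 : ℂ) else 0)ᵀ ^ (i : ℕ))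
                *ᵥ (Λᵀ c)) j) •
              (Matrix.of fun i j : Fin N => if (i : ℕ) = (j : ℕ) + 1 then (1 : ℂ) else 0)ᵀ ^ (j : ℕ))
            *ᵥ (Eᵀ c)) = 0) →
        Λᵀ * F = 0) →
      M - (Matrix.of fun i j : Fin N => if (i : ℕ) = (j : ℕ) + 1 then (1 : ℂ) else 0) * M *
          (Matrix.of fun i j : Fin N => if (i : ℕ) = (j : ℕ) + 1 then (1 : ℂ) else 0)ᵀ = G₀ * Hᵀ →
      M * E = F * X₀ →
      M.det ≠ 0 →
      r ≤ 2 * p := by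
  intro r N p G₀ E F M H X₀ hp hE hF hann hM hME hdet
  have hrN : r ≤ N := hE ▸ Matrix.rank_le_height E
  rcases Nat.eq_zero_or_pos N with hN | hN
  · omega
  -- a vanishing displacement forces `M = 0`, contradicting `det M ≠ 0`
  have hdisp : G₀ * Hᵀ ≠ 0 := by
    intro h0
    rw [h0] at hM
    exact hdet (hclR_p1_det_eq_zero hN M hM)
  obtain rfl | rfl : p = 0 ∨ p = 1 := by omega
  · exfalso
    apply hdisp
    ext i j
    simp [Matrix.mul_apply]
  · by_cases hg0 : (fun i => G₀ i 0) = 0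
    · exfalso
      apply hdisp
      have hG0 : G₀ = 0 := by
        ext i k
        rw [Subsingleton.elim k 0]
        exact congr_fun hg0 i
      rw [hG0, Matrix.zero_mul]
    obtain ⟨γ, gt, hγN, hgt0, hggt⟩ := hclR_lo_val_split hN (fun i => G₀ i 0) hg0
    have hG : G₀ = Matrix.of fun (i : Fin N) (_ : Fin 1) =>
        ((Matrix.of fun i j : Fin N => if (i : ℕ) = (j : ℕ) + 1 then (1 : ℂ) else 0) ^ γ *ᵥ gt) i := by
      ext i k
      rw [Matrix.of_apply, ← congr_fun hggt i, Subsingleton.elim k 0]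
    subst hG
    have h := hclR_p1_core r N γ hN hγN gt hgt0 E F M H X₀ hE hF hann hM hME hdet
    omega

end Summit.MatrixMultiplication.MatrixMultiplication.Theorems
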